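import Literature.Computability.Cryptography.ImpagliazzoLevinHashing
import Literature.Computability.Cryptography.OneWayFunctions
import Literature.Computability.MetaComplexity.HeuristicClasses
import HarnessLib

/-!
# Impagliazzo–Levin inversion, II: the reduction (language, inverter) and its combinatorics

Bogdanov–Trevisan, *Average-Case Complexity* (ECCC TR06-073 §3.3, Thm. 22 = FnT TCS 2(1) §4.3):
"If `(NP, U) ⊆ HeurBPP`, then for every polynomial-time computable family of functions
`f_n : {0,1}^n → {0,1}^*` there is a probabilistic algorithm `I(y; δ)` running in time polynomial in
`n` and `1/δ` such that for every `n`, `Pr_{x ∼ U_n}[I(f_n(x); δ) ∈ f_n^{-1}(f_n(x))] ≥ 1 - δ`" — in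
particular one-way functions do not exist. We formalise the proof along their §5 route (Thm. 29,
Impagliazzo–Levin's reduction, with Claim 28 and the search-to-decision reduction Thm. 21),
specialised to the sampler `x ↦ f(x)` and streamlined as follows (documented deviations):

* **The language.** For `x ∈ {0,1}^n` let `S_x = f^{-1}(f x) ∩ {0,1}^n`, `K = |S_x|`, and let `b`
  be the Valiant–Vazirani level of `K` (`2^{b-2} ≤ K ≤ 2^{b-1}`, `b ≤ n + 2`), `a = n + 4 - b`.
  Instances are uniform strings `z = σ_h ++ σ_g ++ v ++ u ++ junk` where `σ_h` keys an affine hash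
  `h : {0,1}^{p(n)+1} → {0,1}^a` applied to the `10^*`-padded image `ŷ` of `y = f x`
  (`v = h(ŷ)`: B–T's `h(x)|_{k+7}`), `σ_g` keys `g : {0,1}^n → {0,1}^b` (B–T's certificate hash
  `g(r) = 0`, whose range we tune to the VV level so that it *isolates* a preimage: this merges the
  isolation step of Thm. 21 into the encoding of Thm. 29), and the numbers `(b, i)` are carried by
  the **length** of the instance, `|z| = N(n, b, i) = T(n) + (n+3) i + b` (injective in
  `(n, b, i)`), so that all fields are read off in unary. The `NP` language is
  `L_f = {z : ∃ r ∈ {0,1}^n, h(pad(f r)) = v ∧ g(r) = 0^b ∧ r_i = 1}` (`Params.Lang`, verifier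
  relation `Params.Rel`); its witness-length bound is linear (`isPolyVerifierFor`).
* **The inverter** (`Params.inv`): on `⟨1^n, y⟩` it tries every level `b < n + 3` and every coin
  length `κ' ≤ q_A(s(n))` of the heuristic scheme `A` (whose true coin budget `coinLen_A` is an
  arbitrary polynomially bounded function in the tree's model `RandAlg`, hence is not computed but
  exhausted; all queries have the same scheme-input length `s(n)`, the error parameter being chosen
  as `m = m₀ + 4(N_max - N)`), asks the `n` bit-queries `z_{b,0}, …, z_{b,n-1}` built from fresh
  keys, answers each by a majority over `128 n` independent runs of `A`, and outputs the first
  candidate `r` with `f r = y`.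
* **The analysis** (file `ImpagliazzoLevinAnalysis.lean`): with probability `≥ 1/16` over the keys
  the witness set of the queries at the true level is a single preimage `r₀` of `y` (VV isolation,
  `vv_hashStr`, minus parasitic witnesses, `card_hashStr_collide`/`card_hashStr_eq_zeros` — B–T's
  "density"); the good part of the query distribution is dominated by the uniform ensemble with
  factor `8` per level (B–T's "domination" and Claim 28's disjointness argument); majority voting
  makes all `n` answers correct with probability `31/32`; hence `Pr[I inverts] ≥ 31/1024`.

This file contains the construction and its deterministic properties: sizes and their
monotonicity, the decoding of `(b, i)` from lengths (`dec_Nlen`, `dec_eq_none_of_ne`), the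
padding, the fields of a query (`keyH_query`, …), the characterisation of membership of a query in
`L_f` (`query_mem_Lang_iff`), and the consequence of isolation (`mem_Lang_iff_of_isolated`).

## References

* A. Bogdanov, L. Trevisan, *Average-Case Complexity*, ECCC TR06-073 (2006); Found. Trends TCS
  2(1) (2006): §3.3 Thm. 22; §3.2 Thm. 21; §5.1.1 (search reductions), Claim 28, §5.1.3 Thm. 29,
  Cor. 30 ("if `(BH, U^{BH})` has heuristic algorithms … then no one-way functions exist").
* R. Impagliazzo, L. Levin, *No better ways to generate hard NP instances than picking uniformly
  at random*, FOCS 1990, §2 (reductions `R, Q`), §4 (the construction `F`, clauses 1–3).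
* S. Ben-David, B. Chor, O. Goldreich, M. Luby, *On the theory of average case complexity*,
  JCSS 44 (1992) (search-to-decision); L. Valiant, V. Vazirani, TCS 47 (1986) (isolation).
-/

namespace Literature.Computability.Cryptography

namespace ImpagliazzoLevin

open Finset Complexity Complexity.Nondeterministic MetaComplexity AffineStr _root_.Computability

/-! ### Sizes -/

/-- Key length of the isolating hash `g : {0,1}^n → {0,1}^b`, `b ≤ n + 2`: `(n+2)(n+1)` bits
(row `j` at bits `j(n+1) … j(n+1)+n`). [folklore] -/
def Lg (n : ℕ) : ℕ := (n + 2) * (n + 1)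

/-- Number of independent runs of the heuristic scheme per query: `128 n`. [Bogdanov–Trevisan 2006,
Def. 2.12 (remark: the constant `1/4` can be amplified)] [folklore] -/
def Tm (n : ℕ) : ℕ := 128 * n

/-- The base error parameter `m₀ = 256 n (n+3)` of the queries (`δ = 1/m`). [folklore] -/
def m0 (n : ℕ) : ℕ := 256 * n * (n + 3)

/-- The junk pool: `n²(n+3) + (n+3)n` uniform bits, enough for every query at lengths `n`. [folklore] -/
def Jpool (n : ℕ) : ℕ := n ^ 2 * (n + 3) + (n + 3) * n

/-- Junk length of the query `(b, i)`: `n²(n+3) + (n+3) i + b`. [folklore] -/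
def Jn (n b i : ℕ) : ℕ := n ^ 2 * (n + 3) + (n + 3) * i + b

/-- `g_σ(r)`: the affine hash `{0,1}^n → {0,1}^b` keyed by `σ` (`AffineStr.hashStr`).
[Impagliazzo–Levin 1990, §4] [cite: ImpagliazzoLevin1990, §4] -/
def hG (n b : ℕ) (σ r : List Bool) : List Bool := AffineStr.hashStr n b σ r

/-- **The data of the reduction**: the function `f` to invert and a bound `p` on its output
length (the standing hypothesis `∀ x, |f x| ≤ p(|x|)` of the analysis). [Bogdanov–Trevisan 2006, Thm. 22 ("polynomial-time
computable family `f_n : {0,1}^n → {0,1}^*`")] [cite: BogdanovTrevisan2006, Thm. 22 (ECCC TR06-073 §3.3)] -/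
structure Params where
  /-- the candidate one-way function [folklore] -/
  f : List Bool → List Bool
  /-- output-length bound: `|f x| ≤ p |x|` [folklore] -/
  p : Polynomial ℕ

namespace Params

variable (P : Params)

/-- Length `p(n) + 1` of padded images. [Goldreich 2001, §2.2.3.2, eq. (2.3)] [folklore] -/
def Pd (n : ℕ) : ℕ := P.p.eval n + 1

/-- Key length of `h : {0,1}^{p(n)+1} → {0,1}^a`, `a ≤ n + 4`: `(n+4)(p(n)+2)` bits. [folklore] -/
def Lh (n : ℕ) : ℕ := (n + 4) * (P.Pd n + 1)

/-- Width of the core of a query: the two keys and the `n + 4` bits `h(ŷ) ++ u↾b`. [folklore] -/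
def W (n : ℕ) : ℕ := P.Lh n + Lg n + (n + 4)

/-- Base length `T(n) = W(n) + n²(n+3)`; instances at `n` have lengths in `[T(n), T(n) + (n+3)n)`,
and `T(n+1) ≥ T(n) + (n+3)n` keeps these ranges disjoint. [folklore] -/
def Tl (n : ℕ) : ℕ := P.W n + n ^ 2 * (n + 3)

/-- **Instance length of the query `(b, i)` at `n`**: `N(n,b,i) = W(n) + J(n,b,i) = T(n) + (n+3) i + b`.
[folklore] -/
def Nlen (n b i : ℕ) : ℕ := P.W n + Jn n b i

/-- An upper bound on all instance lengths at `n`. [folklore] -/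
def Nmax (n : ℕ) : ℕ := P.W n + Jpool n + (n + 2)

/-- **Error parameter of the query `(b, i)`**: `m = m₀ + 4(N_max - N)`, so that `4N + m`, hence the
length of the scheme input `⟨z, ⟨1^N, 1^m⟩⟩`, is the same for all queries at `n` (`length_schemeEnc_query`).
[folklore] -/
def mOf (n b i : ℕ) : ℕ := m0 n + 4 * (P.Nmax n - P.Nlen n b i)

/-- The common length `s(n) = 4 N_max + m₀ + 4` of the scheme inputs of all queries at `n`. [folklore] -/
def slen (n : ℕ) : ℕ := 4 * P.Nmax n + m0 n + 4

/-- Length of the seed part of a round: keys, `u`, junk pool. [folklore] -/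
def Dn (n : ℕ) : ℕ := P.Lh n + (Lg n + ((n + 4) + Jpool n))

/-- **The `10^*` padding** of images to the common length `p(n) + 1`: `ŷ = y 1 0^{p(n) - |y|}`
(injective on `|y| ≤ p(n)`, `pad_injective`). [Goldreich 2001, §2.2.3.2, eq. (2.3)] [folklore] -/
def pad (n : ℕ) (y : List Bool) : List Bool := y ++ true :: List.replicate (P.p.eval n - y.length) false

/-! ### Decoding `(b, i)` from the lengths -/

/-- **Decoding the level and the bit index from the lengths**: at witness length `n` and instance
length `N`, `(b, i) = ((N - T(n)) mod (n+3), (N - T(n)) / (n+3))` if `T(n) ≤ N` and the quotient is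
`< n`, and nothing otherwise. [folklore] -/
def dec (n N : ℕ) : Option (ℕ × ℕ) :=
  if P.Tl n ≤ N ∧ (N - P.Tl n) / (n + 3) < n then some ((N - P.Tl n) % (n + 3), (N - P.Tl n) / (n + 3))
  else none

/-! ### Fields of an instance, the verifier relation and the language -/

/-- The key of `h`: the first `L_h(n)` bits. [folklore] -/
def keyH (n : ℕ) (z : List Bool) : List Bool := z.take (P.Lh n)

/-- The key of `g`: the next `L_g(n)` bits. [folklore] -/
def keyG (n : ℕ) (z : List Bool) : List Bool := (z.drop (P.Lh n)).take (Lg n)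

/-- The hash-value field `v`: the next `a = n + 4 - b` bits. [folklore] -/
def vf (n b : ℕ) (z : List Bool) : List Bool := (z.drop (P.Lh n + Lg n)).take (n + 4 - b)

/-- `h_σ(w)`: the affine hash `{0,1}^{p(n)+1} → {0,1}^{n+4-b}` keyed by `σ` (`AffineStr.hashStr`).
[Carter–Wegman 1979; Impagliazzo–Levin 1990, §4] [cite: ImpagliazzoLevin1990, §4] -/
def hH (n b : ℕ) (σ w : List Bool) : List Bool := hashStr (P.Pd n) (n + 4 - b) σ w

/-- **The verifier's predicate** on (instance, witness): with `n = |r|` and `(b, i)` decoded from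
`(|r|, |z|)`: `h(pad(f r)) = v`, `g(r) = 0^b` and `r_i = 1`. (Impagliazzo–Levin's `F`: "`F` outputs
`0…0` if `h(ar+b) ≠ f(w)`, otherwise `((f(w)c)_{<k}, a, b, c)`"; Bogdanov–Trevisan's machine `M`:
"guess `r` such that `h(S(n;r)) = y` and `g(r) = 0`", plus the bit test of Thm. 21.)
[Bogdanov–Trevisan 2006, §5.1.3 (the machine `M`) and §3.2 (queries `(x, h, i, j)`)]
[cite: BogdanovTrevisan2006, Thm. 29 (ECCC TR06-073 §5.1.3, reduction R)] -/
def RelPred (z r : List Bool) : Prop :=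
  ∃ b i : ℕ, P.dec r.length z.length = some (b, i) ∧
    P.hH r.length b (P.keyH r.length z) (P.pad r.length (P.f r)) = P.vf r.length b z ∧
    hG r.length b (P.keyG r.length z) r = List.replicate b false ∧ r.getD i false = true

/-- The verifier relation as a language of pairs `⟨z, r⟩`. [Bogdanov–Trevisan 2006, §5.1.3]
[cite: BogdanovTrevisan2006, Thm. 29 (ECCC TR06-073 §5.1.3)] -/
def Rel : Language Bool := {w | P.RelPred (boolUnpair w).1 (boolUnpair w).2}

/-- **The `NP` language `L_f` of the reduction**: instances having a witness. [Bogdanov–Trevisan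
2006, §5.1.3 with §3.2 (`L'`)] [cite: BogdanovTrevisan2006, Thm. 29 (ECCC TR06-073 §5.1.3)] -/
def Lang : Language Bool := {z | ∃ r, P.RelPred z r}

/-! ### The queries -/

/-- **The query `(b, i)`** on image `y` with keys `σ_h, σ_g`, pad bits `u` and junk `pool`:
`σ_h ++ σ_g ++ h(ŷ) ++ u↾b ++ pool↾J(n,b,i)` (B–T's `(h(x), h, g, k)` with the extra randomness
`u`, `pool` of a randomised encoding, §5.1). [Bogdanov–Trevisan 2006, §5.1.3 (reduction `R`)]
[cite: BogdanovTrevisan2006, Thm. 29 (ECCC TR06-073 §5.1.3, reduction R)] -/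
def query (n b i : ℕ) (y σh σg u pool : List Bool) : List Bool :=
  σh ++ σg ++ P.hH n b σh (P.pad n y) ++ u.take b ++ pool.take (Jn n b i)

end Params

/-! ### Elementary arithmetic of the sizes -/

/-- `|1ⁿ| = n` for Mathlib's unary numerals. [folklore] -/
theorem length_unaryEncodeNat (n : ℕ) : (unaryEncodeNat n).length = n := unary_decode_encode_nat n

namespace Params

variable (P : Params)

/-- `Pd` is monotone. [folklore] -/
theorem Pd_mono {a b : ℕ} (h : a ≤ b) : P.Pd a ≤ P.Pd b := Nat.succ_le_succ (TM2Iter.eval_mono P.p h)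

/-- `Lh` is monotone. [folklore] -/
theorem Lh_mono {a b : ℕ} (h : a ≤ b) : P.Lh a ≤ P.Lh b :=
  Nat.mul_le_mul (by omega) (Nat.succ_le_succ (P.Pd_mono h))

/-- `Lg` is monotone. [folklore] -/
theorem Lg_mono {a b : ℕ} (h : a ≤ b) : Lg a ≤ Lg b := Nat.mul_le_mul (by omega) (by omega)

/-- `W` is monotone. [folklore] -/
theorem W_mono {a b : ℕ} (h : a ≤ b) : P.W a ≤ P.W b := by
  unfold W; have := P.Lh_mono h; have := Lg_mono h; omega

/-- **The gaps of `T`**: `T(n) + (n+3) n ≤ T(n+1)`. [folklore] -/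
theorem Tl_add_le_Tl_succ (n : ℕ) : P.Tl n + (n + 3) * n ≤ P.Tl (n + 1) := by
  unfold Tl
  have hW := P.W_mono (Nat.le_succ n)
  nlinarith

/-- `T` is monotone. [folklore] -/
theorem Tl_mono : Monotone P.Tl :=
  monotone_nat_of_le_succ fun n => le_trans (Nat.le_add_right _ _) (P.Tl_add_le_Tl_succ n)

/-- Instance lengths of different witness lengths are separated: for `n < n'`,
`T(n) + (n+3) n ≤ T(n')`. [folklore] -/
theorem Tl_add_le_Tl_of_lt {n n' : ℕ} (h : n < n') : P.Tl n + (n + 3) * n ≤ P.Tl n' :=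
  (P.Tl_add_le_Tl_succ n).trans (P.Tl_mono h)

/-- `N(n,b,i) = T(n) + (n+3) i + b`. [folklore] -/
theorem Nlen_eq (n b i : ℕ) : P.Nlen n b i = P.Tl n + (n + 3) * i + b := by
  unfold Nlen Tl Jn; ring

/-- `N(n,b,i) < T(n) + (n+3) n` for `b < n + 3`, `i < n`. [folklore] -/
theorem Nlen_lt {n b i : ℕ} (hb : b < n + 3) (hi : i < n) : P.Nlen n b i < P.Tl n + (n + 3) * n := by
  rw [Nlen_eq]
  have : (n + 3) * i + b < (n + 3) * (i + 1) := by nlinarith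
  have : (n + 3) * (i + 1) ≤ (n + 3) * n := Nat.mul_le_mul_left _ hi
  omega

/-- `N(n,b,i) ≤ N_max(n)` for `b ≤ n + 2`, `i < n`. [folklore] -/
theorem Nlen_le_Nmax {n b i : ℕ} (hb : b ≤ n + 2) (hi : i < n) : P.Nlen n b i ≤ P.Nmax n := by
  unfold Nlen Nmax Jn Jpool
  have : (n + 3) * i ≤ (n + 3) * n := Nat.mul_le_mul_left _ hi.le
  omega

/-- `J(n,b,i) ≤ J_pool(n)` for `b ≤ n + 2`, `i < n`. [folklore] -/
theorem Jn_le_Jpool {n b i : ℕ} (hb : b ≤ n + 2) (hi : i < n) : Jn n b i ≤ Jpool n := by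
  unfold Jn Jpool
  have : (n + 3) * i + (n + 2) ≤ (n + 3) * n := by nlinarith
  omega

/-- **`4N + m` is constant over the queries at `n`**: `4 N(n,b,i) + m(n,b,i) = 4 N_max(n) + m₀(n)`.
[folklore] -/
theorem four_mul_Nlen_add_mOf {n b i : ℕ} (hb : b ≤ n + 2) (hi : i < n) :
    4 * P.Nlen n b i + P.mOf n b i = 4 * P.Nmax n + m0 n := by
  unfold mOf; have := P.Nlen_le_Nmax hb hi; omega

/-- The error parameters are at least `m₀`. [folklore] -/
theorem m0_le_mOf (n b i : ℕ) : m0 n ≤ P.mOf n b i := Nat.le_add_right _ _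

/-- `m₀(n) > 0` for `n ≥ 1`. [folklore] -/
theorem m0_pos {n : ℕ} (hn : 0 < n) : 0 < m0 n := by unfold m0; positivity

/-- **All scheme inputs at `n` have length `s(n)`**: `|⟨z, ⟨1^N, 1^m⟩⟩| = 4 N_max + m₀ + 4` for
`|z| = N = N(n,b,i)`, `m = m(n,b,i)`. [Bogdanov–Trevisan 2006, Def. 2.12 (inputs `(x; n, δ)`)]
[folklore] -/
theorem length_schemeEnc_query {n b i : ℕ} (hb : b ≤ n + 2) (hi : i < n) {z : List Bool}
    (hz : z.length = P.Nlen n b i) :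
    (schemeEnc (z, P.Nlen n b i, P.mOf n b i)).length = P.slen n := by
  have h := P.four_mul_Nlen_add_mOf hb hi
  simp only [schemeEnc, length_boolPair, length_unaryEncodeNat, hz, slen]
  omega

/-! ### Decoding -/

/-- **Decoding is correct on query lengths**: `dec n (N(n,b,i)) = (b, i)` for `b < n+3`, `i < n`.
[folklore] -/
theorem dec_Nlen {n b i : ℕ} (hb : b < n + 3) (hi : i < n) : P.dec n (P.Nlen n b i) = some (b, i) := by
  unfold dec
  have h1 : P.Nlen n b i - P.Tl n = (n + 3) * i + b := by rw [Nlen_eq]; omega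
  have hdiv : ((n + 3) * i + b) / (n + 3) = i := by
    rw [Nat.add_comm, Nat.add_mul_div_left _ _ (by omega), Nat.div_eq_of_lt hb, Nat.zero_add]
  have hmod : ((n + 3) * i + b) % (n + 3) = b := by
    rw [Nat.add_comm, Nat.add_mul_mod_self_left, Nat.mod_eq_of_lt hb]
  rw [h1, hdiv, hmod, if_pos ⟨by rw [Nlen_eq]; omega, hi⟩]

/-- **Decoding rejects other witness lengths**: `dec n' (N(n,b,i)) = none` for `n' ≠ n`
(`b < n+3`, `i < n`), by the separation of the length ranges. [folklore] -/
theorem dec_eq_none_of_ne {n n' b i : ℕ} (hb : b < n + 3) (hi : i < n) (hn : n' ≠ n) :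
    P.dec n' (P.Nlen n b i) = none := by
  unfold dec
  rw [if_neg]
  rintro ⟨h1, h2⟩
  have hN := P.Nlen_lt hb hi
  rcases lt_or_gt_of_ne hn with hlt | hgt
  · -- `n' < n`: the quotient is at least `n'`
    have hsep := P.Tl_add_le_Tl_of_lt hlt
    have hge : P.Tl n' + (n' + 3) * n' ≤ P.Nlen n b i := hsep.trans (by rw [Nlen_eq]; omega)
    have : n' ≤ (P.Nlen n b i - P.Tl n') / (n' + 3) := by
      rw [Nat.le_div_iff_mul_le (by omega)]
      have : (n' + 3) * n' ≤ P.Nlen n b i - P.Tl n' := by omega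
      linarith [Nat.mul_comm (n' + 3) n']
    omega
  · -- `n < n'`: the instance is shorter than `T(n')`
    have hsep := P.Tl_add_le_Tl_of_lt hgt
    omega

/-- A successful decoding pins the instance length to the query range of the witness length.
[folklore] -/
theorem dec_eq_some_iff {n N b i : ℕ} :
    P.dec n N = some (b, i) ↔ P.Tl n ≤ N ∧ i < n ∧ b = (N - P.Tl n) % (n + 3) ∧ i = (N - P.Tl n) / (n + 3) := by
  unfold dec
  constructor
  · intro h
    split_ifs at h with hc
    · simp only [Option.some.injEq, Prod.mk.injEq] at h
      exact ⟨hc.1, h.2 ▸ hc.2, h.1.symm, h.2.symm⟩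
  · rintro ⟨h1, h2, rfl, rfl⟩
    rw [if_pos ⟨h1, h2⟩]

/-- A decodable pair has `n ≤ |z|` (indeed `T(n) ≤ |z|`): the witness-length bound of the verifier.
[folklore] -/
theorem le_of_dec_eq_some {n N b i : ℕ} (h : P.dec n N = some (b, i)) : n ≤ N := by
  rw [dec_eq_some_iff] at h
  have : n ≤ P.Tl n := by unfold Tl W; nlinarith
  omega

/-! ### Padding -/

/-- Length of a padded image: `p(n) + 1` when `|y| ≤ p(n)`. [Goldreich 2001, eq. (2.3)] [folklore] -/
theorem length_pad {n : ℕ} {y : List Bool} (hy : y.length ≤ P.p.eval n) : (P.pad n y).length = P.Pd n := by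
  simp only [pad, List.length_append, List.length_cons, List.length_replicate, Pd]; omega

/-- `Yao.unpad (pad y) = y` (drop the trailing `0`s and the final `1`). [folklore] -/
theorem unpad_pad (n : ℕ) (y : List Bool) : Yao.unpad (P.pad n y) = y := by
  simp only [Yao.unpad, pad, List.reverse_append, List.reverse_cons, List.reverse_replicate,
    List.append_assoc, List.singleton_append]
  rw [List.dropWhile_append_of_pos ?_]
  · simp
  · intro b hb
    rw [List.mem_replicate] at hb
    simp [hb.2]

/-- **The padding is injective** (at each `n`). [Goldreich 2001, §2.2.3.2] [folklore] -/
theorem pad_injective (n : ℕ) : Function.Injective (P.pad n) := fun y y' h => by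
  have := congrArg Yao.unpad h
  rwa [unpad_pad, unpad_pad] at this

/-! ### Fields of a query -/

section Fields

variable {P} {n b i : ℕ} {y σh σg u pool : List Bool}

/-- Length of `h`-values. [folklore] -/
@[simp] theorem length_hH (n b : ℕ) (σ w : List Bool) : (P.hH n b σ w).length = n + 4 - b := length_hashStr _ _ _ _

/-- Length of `g`-values. [folklore] -/
@[simp] theorem length_hG (n b : ℕ) (σ r : List Bool) : (hG n b σ r).length = b := length_hashStr _ _ _ _

/-- **Length of a query**: `|z_{b,i}| = N(n,b,i)` (keys, pad and pool of the right lengths,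
`b ≤ n + 4`... precisely `b ≤ n + 2`). [folklore] -/
theorem length_query (hσh : σh.length = P.Lh n) (hσg : σg.length = Lg n) (hu : u.length = n + 4)
    (hpool : pool.length = Jpool n) (hb : b ≤ n + 2) (hi : i < n) :
    (P.query n b i y σh σg u pool).length = P.Nlen n b i := by
  have hJ := Jn_le_Jpool hb hi
  simp only [query, List.length_append, hσh, hσg, length_hH, List.length_take, hu, hpool, Nlen, W,
    Nat.min_eq_left hJ]
  omega

/-- The `h`-key of a query. [folklore] -/
theorem keyH_query (hσh : σh.length = P.Lh n) : P.keyH n (P.query n b i y σh σg u pool) = σh := by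
  simp only [keyH, query, List.append_assoc]
  rw [List.take_left' hσh]

/-- The `g`-key of a query. [folklore] -/
theorem keyG_query (hσh : σh.length = P.Lh n) (hσg : σg.length = Lg n) :
    P.keyG n (P.query n b i y σh σg u pool) = σg := by
  simp only [keyG, query, List.append_assoc]
  rw [List.drop_left' hσh, List.take_left' hσg]

/-- The `v`-field of a query is `h(ŷ)`. [folklore] -/
theorem vf_query (hσh : σh.length = P.Lh n) (hσg : σg.length = Lg n) :
    P.vf n b (P.query n b i y σh σg u pool) = P.hH n b σh (P.pad n y) := by
  simp only [vf, query, List.append_assoc]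
  rw [← List.append_assoc σh, List.drop_left' (by simp [hσh, hσg]), List.take_left' (length_hH _ _ _ _)]

end Fields

/-! ### Membership of queries in the language -/

section Membership

variable {P} {n b i : ℕ} {y σh σg u pool : List Bool}

/-- **The verifier on a query**: `⟨z_{b,i}, r⟩` is accepted iff `|r| = n`, `h(pad(f r)) = h(ŷ)`,
`g(r) = 0^b` and `r_i = 1` (the lengths decode to `(b, i)` exactly when `|r| = n`). [Bogdanov–Trevisan
2006, §5.1.3 ("when `(y, h, g, k) ∈ V_x`, `M(y, h, g, k)` performs the same computation as `M_L(x)`")]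
[cite: BogdanovTrevisan2006, Thm. 29 (ECCC TR06-073 §5.1.3)] -/
theorem relPred_query_iff (hσh : σh.length = P.Lh n) (hσg : σg.length = Lg n) (hu : u.length = n + 4)
    (hpool : pool.length = Jpool n) (hb : b ≤ n + 2) (hi : i < n) (r : List Bool) :
    P.RelPred (P.query n b i y σh σg u pool) r ↔
      r.length = n ∧ P.hH n b σh (P.pad n (P.f r)) = P.hH n b σh (P.pad n y) ∧
        hG n b σg r = List.replicate b false ∧ r.getD i false = true := by
  have hlen := length_query (y := y) hσh hσg hu hpool hb hi
  constructor
  · rintro ⟨b', i', hdec, h1, h2, h3⟩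
    rw [hlen] at hdec
    have hrn : r.length = n := by
      by_contra hne
      rw [P.dec_eq_none_of_ne (by omega) hi hne] at hdec
      simp at hdec
    rw [hrn, P.dec_Nlen (by omega) hi] at hdec
    simp only [Option.some.injEq, Prod.mk.injEq] at hdec
    obtain ⟨rfl, rfl⟩ := hdec
    rw [hrn, keyH_query hσh, vf_query hσh hσg] at h1
    rw [hrn, keyG_query hσh hσg] at h2
    exact ⟨hrn, h1, h2, h3⟩
  · rintro ⟨hrn, h1, h2, h3⟩
    refine ⟨b, i, ?_, ?_, ?_, h3⟩
    · rw [hlen, hrn]; exact P.dec_Nlen (by omega) hi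
    · rw [hrn, keyH_query hσh, vf_query hσh hσg]; exact h1
    · rw [hrn, keyG_query hσh hσg]; exact h2

/-- **Membership of a query in `L_f`**: `z_{b,i} ∈ L_f` iff some `r ∈ {0,1}^n` has
`h(pad(f r)) = h(ŷ)`, `g(r) = 0^b` and `r_i = 1`. [Bogdanov–Trevisan 2006, §5.1.3 with §3.2]
[cite: BogdanovTrevisan2006, Thm. 29 (ECCC TR06-073 §5.1.3)] -/
theorem query_mem_Lang_iff (hσh : σh.length = P.Lh n) (hσg : σg.length = Lg n) (hu : u.length = n + 4)
    (hpool : pool.length = Jpool n) (hb : b ≤ n + 2) (hi : i < n) :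
    P.query n b i y σh σg u pool ∈ P.Lang ↔ ∃ r : List.Vector Bool n,
      P.hH n b σh (P.pad n (P.f r.toList)) = P.hH n b σh (P.pad n y) ∧
        hG n b σg r.toList = List.replicate b false ∧ r.toList.getD i false = true := by
  change (∃ r, P.RelPred _ r) ↔ _
  constructor
  · rintro ⟨r, hr⟩
    rw [relPred_query_iff hσh hσg hu hpool hb hi] at hr
    exact ⟨⟨r, hr.1⟩, hr.2⟩
  · rintro ⟨r, hr⟩
    exact ⟨r.toList, (relPred_query_iff hσh hσg hu hpool hb hi r.toList).2 ⟨r.toList_length, hr⟩⟩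

/-- The witness set of the queries at level `b` with keys `σ_h, σ_g` on image `y`:
`{r ∈ {0,1}^n : h(pad(f r)) = h(ŷ) ∧ g(r) = 0^b}` (B–T's `r` with `h(S(n;r)) = y`, `g(r) = 0`).
[Bogdanov–Trevisan 2006, §5.1.3 (`V_x`, conditions (1)–(2))] [cite: BogdanovTrevisan2006, Thm. 29 (ECCC TR06-073 §5.1.3)] -/
def witSet (P : Params) (n b : ℕ) (y σh σg : List Bool) : Finset (List.Vector Bool n) :=
  univ.filter fun r => P.hH n b σh (P.pad n (P.f r.toList)) = P.hH n b σh (P.pad n y) ∧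
    hG n b σg r.toList = List.replicate b false

/-- **Isolation determines all answers**: if the witness set is the single string `r₀`, then for
every `i < n`, `z_{b,i} ∈ L_f ↔ (r₀)_i = 1` — the sequence of correct answers spells `r₀`
(Bogdanov–Trevisan's Thm. 21: "the sequence of oracle answers … allows the search algorithm to recover
all the bits of the unique witness"). [Bogdanov–Trevisan 2006, §3.2 (unique witnesses)]
[cite: BogdanovTrevisan2006, Thm. 21 (ECCC TR06-073 §3.2)] -/
theorem mem_Lang_iff_of_isolated (hσh : σh.length = P.Lh n) (hσg : σg.length = Lg n) (hu : u.length = n + 4)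
    (hpool : pool.length = Jpool n) (hb : b ≤ n + 2) (hi : i < n) {r₀ : List.Vector Bool n}
    (hW : witSet P n b y σh σg = {r₀}) :
    P.query n b i y σh σg u pool ∈ P.Lang ↔ r₀.toList.getD i false = true := by
  rw [query_mem_Lang_iff hσh hσg hu hpool hb hi]
  have hmem : ∀ r : List.Vector Bool n, r ∈ witSet P n b y σh σg ↔ r = r₀ := by
    intro r; rw [hW, mem_singleton]
  simp only [witSet, mem_filter, mem_univ, true_and] at hmem
  constructor
  · rintro ⟨r, h1, h2, h3⟩
    rw [← (hmem r).1 ⟨h1, h2⟩]; exact h3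
  · intro h3
    exact ⟨r₀, ((hmem r₀).2 rfl).1, ((hmem r₀).2 rfl).2, h3⟩

end Membership

/-- **The verifier relation has linear witness length**: `L_f = {z : ∃ r, |r| ≤ |z| ∧ ⟨z, r⟩ ∈ Rel}`,
since a decodable witness length `n` has `n ≤ T(n) ≤ |z|`. Hence `L_f ∈ NP` as soon as `Rel ∈ P`
(`Lang_mem_NP_of`). [Arora–Barak 2009, Def. 2.1] [folklore] -/
theorem isPolyVerifierFor : IsPolyVerifierFor P.Rel Polynomial.X P.Lang := by
  intro z
  change (∃ r, P.RelPred z r) ↔ _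
  constructor
  · rintro ⟨r, hr⟩
    obtain ⟨b, i, hdec, -⟩ := id hr
    refine ⟨r, ?_, ?_⟩
    · rw [Polynomial.eval_X]; exact P.le_of_dec_eq_some hdec
    · change P.RelPred (boolUnpair (boolPair z r)).1 (boolUnpair (boolPair z r)).2
      rwa [boolUnpair_boolPair]
  · rintro ⟨r, -, hr⟩
    change P.RelPred (boolUnpair (boolPair z r)).1 (boolUnpair (boolPair z r)).2 at hr
    rw [boolUnpair_boolPair] at hr
    exact ⟨r, hr⟩

/-- **`L_f ∈ NP` if its verifier relation is in `P`.** [Arora–Barak 2009, Def. 2.1]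
[cite: AroraBarak2009, Def. 2.1] -/
theorem Lang_mem_NP_of (h : P.Rel ∈ Classes.P) : P.Lang ∈ NP :=
  mem_NP_iff_verifier.2 ⟨P.Rel, h, Polynomial.X, P.isPolyVerifierFor⟩

end Params

/-! ### The inverter -/

/-- **The adversary data**: the randomized heuristic scheme `A(z; 1^N, 1^m)` for `(L_f, U)` and a
polynomial bound `q_A` on its coin budget. [Bogdanov–Trevisan 2006, Def. 2.12] [folklore] -/
structure Adv where
  /-- the randomized heuristic scheme [folklore] -/
  A : RandAlg (List Bool × ℕ × ℕ) Bool
  /-- coin bound: `coinLen_A ≤ q_A` [folklore] -/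
  qA : Polynomial ℕ

namespace Params

variable (P : Params) (Ad : Adv)

/-- The largest coin length of `A` to try: `Q(n) = q_A(s(n))`. [folklore] -/
def Q (n : ℕ) : ℕ := Ad.qA.eval (P.slen n)

/-- Length of the coin part of a round: `n` query segments of `128 n` blocks of `≤ Q(n)` coins. [folklore] -/
def Cn (n : ℕ) : ℕ := P.Q Ad n * Tm n * n

/-- Length of a round segment: seeds then coins. [folklore] -/
def Rn (n : ℕ) : ℕ := P.Dn n + P.Cn Ad n

/-- Number of rounds: all levels `b < n + 3` times all coin lengths `κ' ≤ Q(n)`. [folklore] -/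
def rounds (n : ℕ) : ℕ := (n + 3) * (P.Q Ad n + 1)

/-- **The answer to query `i`**: the majority over `128 n` runs of `A(z_{b,i}; 1^N, 1^m)` on the
consecutive `κ`-blocks of the `i`-th coin segment (of length `128 n κ`). [Bogdanov–Trevisan 2006,
Def. 2.12 (and the remark on amplifying `1/4`); proof of Claim 28 (`A'(y_i; p(n), δ/2q₂(n))`)]
[cite: BogdanovTrevisan2006, Claim 28 (ECCC TR06-073 §5.1.1)] -/
def answer (n b i κ : ℕ) (z ac : List Bool) : Bool :=
  maj ((List.range (Tm n)).map fun t => Ad.A.run (z, P.Nlen n b i, P.mOf n b i) (seg κ t (seg (κ * Tm n) i ac)))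

/-- **The query `(b, i)` built from a seed string** `s = σ_h ++ σ_g ++ u ++ pool` (fields cut
successively: `L_h` bits, `L_g` bits, `n + 4` bits, `J_pool(n)` bits). [Bogdanov–Trevisan 2006, §5.1.3 (reduction `R`)]
[cite: BogdanovTrevisan2006, Thm. 29 (ECCC TR06-073 §5.1.3, reduction R)] -/
def squery (n b i : ℕ) (y s : List Bool) : List Bool :=
  P.query n b i y (s.take (P.Lh n)) ((s.drop (P.Lh n)).take (Lg n)) (((s.drop (P.Lh n)).drop (Lg n)).take (n + 4))
    ((((s.drop (P.Lh n)).drop (Lg n)).drop (n + 4)).take (Jpool n))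

/-- **The candidate of a round** at level `b` with coin length `κ` on image `y` and round segment
`sd` (seeds `sd ↾ D(n)`, coins `sd ⇂ D(n)`): the string of the `n` answers. [Bogdanov–Trevisan 2006,
§3.2 ("if the sequence of answers … is an `L`-witness, output this witness")]
[cite: BogdanovTrevisan2006, Thm. 21 (ECCC TR06-073 §3.2)] -/
def cand (n b κ : ℕ) (y sd : List Bool) : List Bool :=
  (List.range n).map fun i => P.answer Ad n b i κ (P.squery n b i y (sd.take (P.Dn n))) (sd.drop (P.Dn n))

/-- The output of round `j` (level `j mod (n+3)`, coin length `j / (n+3)`) on the `j`-th round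
segment of the coins. [folklore] -/
def roundOut (n j : ℕ) (y r : List Bool) : List Bool :=
  P.cand Ad n (j % (n + 3)) (j / (n + 3)) y (seg (P.Rn Ad n) j r)

/-- **The run function of the inverter** on input `⟨1ⁿ, y⟩` and coins `r`: the first round output
that `f` maps to `y`, if any (else `ε`). (Claim 28: "If, for some `i`, `Q(w_i)` is an `L`-witness
for `x`, output `Q(w_i)`, otherwise output an arbitrary string.") [Bogdanov–Trevisan 2006, Claim 28]
[cite: BogdanovTrevisan2006, Claim 28 (ECCC TR06-073 §5.1.1)] -/
def run (inp r : List Bool) : List Bool :=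
  match (List.range (P.rounds Ad (boolUnpair inp).1.length)).find?
      (fun j => P.f (P.roundOut Ad (boolUnpair inp).1.length j (boolUnpair inp).2 r) == (boolUnpair inp).2) with
  | some j => P.roundOut Ad (boolUnpair inp).1.length j (boolUnpair inp).2 r
  | none => []

/-- The coin budget on inputs of length `ℓ`: all rounds at witness length `ℓ` (an over-estimate of
`n ≤ ℓ`, enough by monotonicity, `rounds_mul_Rn_le_coinLen`). [folklore] -/
def coinLen (ℓ : ℕ) : ℕ := P.rounds Ad ℓ * P.Rn Ad ℓ

/-- **The inverter `I`** as a randomized algorithm. [Bogdanov–Trevisan 2006, Thm. 22 (`I(y; δ)`)]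
[cite: BogdanovTrevisan2006, Thm. 22 (ECCC TR06-073 §3.3)] -/
def inv : RandAlg (List Bool) (List Bool) where
  run := P.run Ad
  coinLen := P.coinLen Ad

/-! ### Properties of the inverter's bookkeeping -/

/-- **A hit in any round is a success**: if some round `j < rounds(n)` produces an `f`-preimage of
`y`, so does the run. [Bogdanov–Trevisan 2006, Claim 28] [folklore] -/
theorem f_run_eq {n : ℕ} {y r : List Bool} {j : ℕ} (hj : j < P.rounds Ad n)
    (hhit : P.f (P.roundOut Ad n j y r) = y) :
    P.f (P.run Ad (boolPair (unaryEncodeNat n) y) r) = y := by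
  unfold run
  simp only [boolUnpair_boolPair, length_unaryEncodeNat]
  cases hfind : (List.range (P.rounds Ad n)).find? (fun j => P.f (P.roundOut Ad n j y r) == y) with
  | none =>
    exfalso
    rw [List.find?_eq_none] at hfind
    exact hfind j (List.mem_range.2 hj) (by simpa using hhit)
  | some j' =>
    simpa using List.find?_some hfind

/-- The round outputs are candidates on round segments (definitional). [folklore] -/
theorem roundOut_eq {n b κ : ℕ} (hb : b < n + 3) (y r : List Bool) :
    P.roundOut Ad n (κ * (n + 3) + b) y r = P.cand Ad n b κ y (seg (P.Rn Ad n) (κ * (n + 3) + b) r) := by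
  unfold roundOut
  rw [Nat.mul_add_mod_of_lt hb, Nat.add_comm, Nat.add_mul_div_right _ _ (by omega), Nat.div_eq_of_lt hb,
    Nat.zero_add]

/-- The round index of `(b, κ)` is below `rounds(n)` when `b < n + 3`, `κ ≤ Q(n)`. [folklore] -/
theorem roundIdx_lt {n b κ : ℕ} (hb : b < n + 3) (hκ : κ ≤ P.Q Ad n) : κ * (n + 3) + b < P.rounds Ad n := by
  unfold rounds; nlinarith

/-- `Q` is monotone. [folklore] -/
theorem Q_mono {a b : ℕ} (h : a ≤ b) : P.Q Ad a ≤ P.Q Ad b := by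
  unfold Q slen Nmax Jpool
  refine TM2Iter.eval_mono _ ?_
  have := P.W_mono h
  have : (a + 3) * a ≤ (b + 3) * b := Nat.mul_le_mul (by omega) h
  have : a ^ 2 * (a + 3) ≤ b ^ 2 * (b + 3) := Nat.mul_le_mul (Nat.pow_le_pow_left h 2) (by omega)
  unfold m0
  nlinarith

/-- `Dn` is monotone. [folklore] -/
theorem Dn_mono {a b : ℕ} (h : a ≤ b) : P.Dn a ≤ P.Dn b := by
  unfold Dn Jpool
  have := P.Lh_mono h; have := Lg_mono h
  have : (a + 3) * a ≤ (b + 3) * b := Nat.mul_le_mul (by omega) h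
  have : a ^ 2 * (a + 3) ≤ b ^ 2 * (b + 3) := Nat.mul_le_mul (Nat.pow_le_pow_left h 2) (by omega)
  omega

/-- `Rn` is monotone. [folklore] -/
theorem Rn_mono {a b : ℕ} (h : a ≤ b) : P.Rn Ad a ≤ P.Rn Ad b := by
  unfold Rn Cn Tm
  have := P.Dn_mono h; have := P.Q_mono Ad h
  have : P.Q Ad a * (128 * a) * a ≤ P.Q Ad b * (128 * b) * b :=
    Nat.mul_le_mul (Nat.mul_le_mul ‹_› (by omega)) h
  omega

/-- `rounds` is monotone. [folklore] -/
theorem rounds_mono {a b : ℕ} (h : a ≤ b) : P.rounds Ad a ≤ P.rounds Ad b := by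
  unfold rounds; exact Nat.mul_le_mul (by omega) (Nat.succ_le_succ (P.Q_mono Ad h))

/-- **The coin budget covers all rounds**: on input `⟨1ⁿ, y⟩` (of length `ℓ ≥ n`) the `rounds(n)`
segments of length `Rn(n)` fit into the `coinLen(ℓ)` coins. [folklore] -/
theorem rounds_mul_Rn_le_coinLen {n ℓ : ℕ} (h : n ≤ ℓ) : P.rounds Ad n * P.Rn Ad n ≤ P.coinLen Ad ℓ :=
  Nat.mul_le_mul (P.rounds_mono Ad h) (P.Rn_mono Ad h)

end Params

end ImpagliazzoLevin

end Literature.Computability.Cryptography
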